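import Summits.BirchSwinnertonDyer.BirchSwinnertonDyer.Theorems.RamifiedHeegnerPairStepLIntrinsic
import HarnessLib

/-!
# STEP L (adjusted, tower-row shape) at the intrinsic rank-one classes — part C: `182853c1`, `250065g1`, `228897c1`

Continuation of `RamifiedHeegnerPairStepLIntrinsic` (door `existsAdjustedStepLAt_of_sqrtField`, conventions, data provenance and the
"what this is NOT" list are in that file's header): per class `E`, the kernel instance `stepL_at_<label>` of the `∃`-body of
`Sig.stub_existsAdjustedStepL_towerRows` (= `hEx` of §5 `RamifiedPairLowerBound.gssLowerAtThree_rankOne_towerRows_of_exists_adjustedIndexBound`,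
the load-bearing stub of line `kolyvagin_split` of crux 26021) over `K = ℚ(√D)`, and `row_<label>` (`Addv ∧ SubGss ∧ ρ_{E,3}` onto). For `182853c1` (`D = -239`) and `250065g1` (`D = -71`) the split discriminant differs from the k1 record's (`-35`, `-56` are not `≡ 1 mod 8`), so `Wd` is new; `228897c1` reuses the k1 `Wd` (`D = -23`).
Seat `bsd-trib-w-rhp` g9; helper `--supports` 23191; data kit j304302 / j304074 / j304038. **BSD is not proved; nothing is booked;
26021 / 23191 / `L₁` stay OPEN.**
[cite: JetchevSkinnerWan2017, §7.4.1 (pp. 29–31)] [cite: GrossZagier1986, Thm. I.(6.3), V.§2] [cite: Darmon2004, Thm. 3.6]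
[cite: Cremona2006, Table 1] [cite: SilvermanAEC2009, VII.1, VII.5]
-/

set_option autoImplicit false

noncomputable section

open scoped Classical NumberField

open WeierstrassCurve NumberField IsDedekindDomain IsDedekindDomain.HeightOneSpectrum Rat.HeightOneSpectrum Field
  Literature.NumberTheory.DiophantineGeometry Literature.NumberTheory.EllipticCurves
  Literature.NumberTheory.EllipticCurves.ModularForms Literature.NumberTheory.EllipticCurves.Rank1Residual
  Literature.NumberTheory.EllipticCurves.Rank1Residual.Typed Literature.NumberTheory.Automorphic
  Literature.NumberTheory.EllipticCurves.Rank1Residual.X11RankOneCertificates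
  Literature.NumberTheory.GaloisRepresentations Literature.NumberTheory.QuadraticFields
  Summit.BirchSwinnertonDyer.BirchSwinnertonDyer.Rank1Residual.IntModel
  Summit.BirchSwinnertonDyer.Rank1Residual Summit.BirchSwinnertonDyer.Rank1Residual.Additive
  Summit.BirchSwinnertonDyer.Rank1Residual.X11b Summit.BirchSwinnertonDyer.Rank1Residual.GaloisImage
  Summit.BirchSwinnertonDyer.Rank1Residual.Supersingular
  Summit.BirchSwinnertonDyer.BirchSwinnertonDyer.Theses.AdditiveKolyvaginRoad
  Summit.BirchSwinnertonDyer.BirchSwinnertonDyer.Theorems.AdditiveKolyvaginKernel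
  Summit.BirchSwinnertonDyer.BirchSwinnertonDyer.Theorems
  Summit.BirchSwinnertonDyer.BirchSwinnertonDyer.Theorems.AdditiveBranchIMCGordTwoRankOne.HeegnerKolyvagin

namespace Summit.BirchSwinnertonDyer.BirchSwinnertonDyer.Theorems.RamifiedHeegnerPairStepLIntrinsic


/-! ## `182853c1` = `[0, 0, 1, -522, -9187]`, `N = 182853 = 3^2·11·1847`, `K = ℚ(√-239)`, `Wd = [0, 0, 1, -29817162, 125416766873]` (`N(Wd) = 10444746213`), kit j304074 -/
/-- `[0, 0, 1, -29817162, 125416766873]` (the minimal model `Wd` of the twist `182853c1^{(-239)}`, change `[u,r,s,t] = [1, 0, 0, 1/2]` from the tree model, conductor `10444746213`) is an elliptic curve: `|Δ| = 3⁶·11·239⁶·1847² ≠ 0`. [cite: Cremona2006, Table 1 (Cremona label 182853c1)] -/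
theorem isElliptic_sWd182853c1 : (⟨0, 0, 1, -29817162, 125416766873⟩ : WeierstrassCurve ℚ).IsElliptic :=
  isElliptic_of_discOf_ne_zero 0 0 1 (-29817162) 125416766873 (by decide +kernel)

/-- `[0, 0, 1, -29817162, 125416766873]` (the minimal model `Wd` of the twist `182853c1^{(-239)}`, change `[u,r,s,t] = [1, 0, 0, 1/2]` from the tree model, conductor `10444746213`) is globally minimal: `|Δ| = 3⁶·11·239⁶·1847²` kernel-checked, Kraus/Silverman prime by prime.
[cite: SilvermanAEC2009, VII.1 Remark 1.1] [cite: Kraus1989, Prop. 1 and Prop. 2] [cite: Cremona2006, Table 1 (Cremona label 182853c1)] -/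
theorem isGloballyMinimal_sWd182853c1 : (⟨0, 0, 1, -29817162, 125416766873⟩ : WeierstrassCurve ℚ).IsGloballyMinimal :=
  isGloballyMinimal_of_krausCriterion₃_factored 0 0 1 (-29817162) 125416766873
    [(3, 6), (11, 1), (239, 6), (1847, 2)] (by decide +kernel)
    (by intro qe hqe; simp only [List.mem_cons, List.not_mem_nil, or_false] at hqe
        rcases hqe with rfl | rfl | rfl | rfl <;> norm_num)
    (by set_option synthInstance.maxSize 2000 in decide +kernel)

/-- **Row membership of `182853c1`, kernel part**: additive (G) ∧ ss at `3` and `ρ_{E,3}` onto (`n = 1` of the tower). The levels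
`n ≥ 2`: `ρ_{E,9}` is onto — Frobenius witnesses `(a_ℓ, ℓ) mod 9 = (6, 8)` at `ℓ = 17` (outside the profile of the 27 index-27 subgroups) and `(1, 5)` at `ℓ = 5` (outside the index-3 subgroup's), these being ALL maximal mod-3-surjective proper subgroups of `GL₂(ℤ/9)`
(exact enumeration, Lines card `stepl_intrinsic.md` of item 23191) — whence `ρ_{E,3^n}` onto for all `n` by Serre's lifting lemma; not typed here.
[cite: Serre1972, IV-23 Lemma 3 with its Exercise 3 (p = 3: surjectivity mod 9 suffices)] [cite: Cremona2006, Table 1 (Cremona label 182853c1)] -/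
theorem row_182853c1 :
    haveI := isElliptic_g182853c1; haveI := isGloballyMinimal_g182853c1
    Addv (⟨0, 0, 1, -522, -9187⟩ : WeierstrassCurve ℚ) 3 ∧ SubGss (⟨0, 0, 1, -522, -9187⟩ : WeierstrassCurve ℚ) 3 ∧ (⟨0, 0, 1, -522, -9187⟩ : WeierstrassCurve ℚ).HasSurjectiveModNGaloisRep (3 ^ 1 : ℕ) := by
  have h : (⟨0, 0, 1, -522, -9187⟩ : WeierstrassCurve ℚ).HasSurjectiveModNGaloisRep ((3 : ℕ) : ℤ) := surj_g182853c1_3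
  exact ⟨subGss_g182853c1_3.1, subGss_g182853c1_3.2, by simpa using h⟩

/-- **STEP L (adjusted, tower-row shape) AT `182853c1` over `K = ℚ(√-239)`** — an instance of the `∃`-body of
`Sig.stub_existsAdjustedStepL_towerRows` (= `hEx` of §5) at an INTRINSIC class (`#Ш(E)_an = 9`). KERNEL: `K = sqrtField (-239)` (imaginary
quadratic, `d_K = -239`), the Heegner hypothesis at `N = 182853` (`-239 ≡ 1 (mod 8)`, `(-239/ℓ) = 1` at the odd `ℓ ∣ N`), the Heegner datum `β = 16495`
(`4N ∣ β² − (-239)`), minimality of `Wd = [0, 0, 1, -29817162, 125416766873]` (`Kraus, above`), the twist identity `Cd • E^{(-239)} = Wd`,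
`[u,r,s,t] = [1, 0, 0, 1/2]` (`3`-unit), `3 ∤ #𝓞_K^×`; `P ∈ E(K)` over the complex Heegner point is Darmon Thm 3.6 (tree theorem
`heegnerPointComplex_mem_range_map_holds`). PUBLISHED binders: `hmodP` (BCDT), `hGZ`, `hKo`, `hGZK`, `hmod`. DISPLAYED numerics: Cremona's
`N(E) = 182853` (`hN`), `r_an(E) = 1` (`hr`), `#Ш(E)_an = q`, `ord₃ q ≤ 2` (`hq`/`hv`), the rigorous 3-descent certificate `27 ∣ #Sel₃(E)` (`hSel`,
L1Intrinsic records), `L(E^{(-239)},1) = 1.0971237783 ≠ 0` (`hLt`; PARI `ellL1` = `lfun`, agree True), `#Ш(Wd)_an = 4` (`hqd`/`hvd`;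
`N(Wd) = 10444746213`, `∏c(Wd) = 4`, `#Wd(ℚ)_tors = 1`). INSTRUMENT (not used in the proof): Gross–Zagier heights give `[E(K):ℤy_K]² /4 = ρ = ĥ(y_K)/ĥ(P_gen) = 144.0`, `m = 24` (`ord₃ m = 1`; float error 3.6e-15); BSD-budget prediction `ord₃ m = (ord₃#Ш(E)_an + ord₃#Ш(Wd)_an + ord₃∏c(E) + ord₃∏c(Wd))/2 = (2+0+0+0)/2 = 1`.
Nothing is booked; L₁ / items 26021, 23191 stay OPEN; BSD is not proved by this.
[cite: JetchevSkinnerWan2017, §7.4.1 (pp. 29–31)] [cite: GrossZagier1986, Thm. I.(6.3), V.§2] [cite: Darmon2004, Thm. 3.6]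
[cite: SchaeferStoll2004, Cor. 5.9] [cite: Marcus2018, Ch. 3 Thm. 25] [cite: Cremona2006, Table 1 (Cremona label 182853c1)] -/
theorem stepL_at_182853c1
    (hmodP : nonempty_modularParametrizationData)
    (hGZ : ∀ (N : ℕ) [NeZero N] (W : WeierstrassCurve ℚ) (K : Type) [Field K] [NumberField K], gross_zagier N W K)
    (hKo : ∀ (N : ℕ) [NeZero N] (W : WeierstrassCurve ℚ) (K : Type) [Field K] [NumberField K], kolyvagin N W K)
    (hGZK : rank_eq_analyticRank_of_analyticRank_le_one) (hmod : hasEntireLFunction_rat)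
    {W : WeierstrassCurve ℚ} [W.IsElliptic] [W.IsGloballyMinimal] (hWeq : W = (⟨0, 0, 1, -522, -9187⟩ : WeierstrassCurve ℚ))
    (hN : W.conductorNorm ℤ = 182853) (hr : W.analyticRank = 1)
    {q : ℚ} (hq : shaAn W = (q : ℂ)) (hv : padicValRat 3 q ≤ 2) (hSel : 3 ^ 3 ∣ Nat.card (W.selmerGroup 3))
    (hLt : (W.quadraticTwist ((-239 : ℤ) : ℚ)).entireLFunction 1 ≠ 0)
    {qd : ℚ} (hqd : haveI := isElliptic_sWd182853c1; shaAn (⟨0, 0, 1, -29817162, 125416766873⟩ : WeierstrassCurve ℚ) = (qd : ℂ)) (hvd : padicValRat 3 qd ≤ 0) :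
    ∃ (N : ℕ) (_ : NeZero N) (K : Type) (_ : Field K) (_ : NumberField K)
      (Dt : ModularParametrizationData W N) (H : HeegnerDatum N (NumberField.discr K)) (ι : K →+* ℂ)
      (P : (W.baseChange K).toAffine.Point)
      (Wd : WeierstrassCurve ℚ) (_ : Wd.IsElliptic) (_ : Wd.IsGloballyMinimal) (Cd : VariableChange ℚ),
      W.conductorNorm ℤ = N ∧ IsImaginaryQuadratic K ∧ SatisfiesHeegnerHypothesis N K ∧
      (W.quadraticTwist (NumberField.discr K : ℚ)).entireLFunction 1 ≠ 0 ∧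
      WeierstrassCurve.Affine.Point.map ι.toRatAlgHom P = heegnerPointComplex Dt H ∧
      Cd • W.quadraticTwist (NumberField.discr K : ℚ) = Wd ∧
      (Finite (W.baseChange K).sha →
        (2 * padicValNat 3 (AddSubgroup.zmultiples P).index : ℤ) ≤
          padicValNat 3 (W.baseChange K).shaOrder + padicValNat 3 W.tamagawaProduct +
            padicValNat 3 Wd.tamagawaProduct + 2 * padicValRat 3 (Dt.c : ℚ)) := by
  subst hWeq
  haveI := isElliptic_sWd182853c1; haveI := isGloballyMinimal_sWd182853c1
  haveI : Fact ((-239 : ℤ) < 0) := ⟨by norm_num⟩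
  haveI : NeZero (182853 : ℕ) := ⟨by norm_num⟩
  have hlow : MissingLowerBoundAt (⟨0, 0, 1, -522, -9187⟩ : WeierstrassCurve ℚ) 3 :=
    RamifiedHeegnerPairL1Intrinsic.lowerHalf_three_182853c1 hGZK hr hq hv hSel
  have hjac : ∀ ℓ : ℕ, ℓ.Prime → ℓ ∣ 182853 → ℓ ≠ 2 → jacobiSym (-239) ℓ = 1 := by
    intro ℓ hℓ hℓN hℓ2
    have hmem : ℓ ∈ Nat.primeFactors 182853 := Nat.mem_primeFactors.mpr ⟨hℓ, hℓN, by norm_num⟩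
    have hpf : Nat.primeFactors 182853 = {3, 11, 1847} := by decide +kernel
    rw [hpf] at hmem
    simp only [Finset.mem_insert, Finset.mem_singleton] at hmem
    rcases hmem with rfl | rfl | rfl
    all_goals norm_num
  have hWd : (⟨1, (0 : ℚ), (0 : ℚ), ((1 : ℚ)/2)⟩ : VariableChange ℚ) •
      (⟨0, 0, 1, -522, -9187⟩ : WeierstrassCurve ℚ).quadraticTwist ((-239 : ℤ) : ℚ) = (⟨0, 0, 1, -29817162, 125416766873⟩ : WeierstrassCurve ℚ) := by
    push_cast
    ext <;> simp [WeierstrassCurve.variableChange_a₁, WeierstrassCurve.variableChange_a₂,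
      WeierstrassCurve.variableChange_a₃, WeierstrassCurve.variableChange_a₄, WeierstrassCurve.variableChange_a₆,
      WeierstrassCurve.quadraticTwist, WeierstrassCurve.b₂, WeierstrassCurve.b₄, WeierstrassCurve.b₆] <;> norm_num
  exact existsAdjustedStepLAt_of_sqrtField _ 182853 (-239) (by norm_num)
    (by rw [show (-239 : ℤ).natAbs = 239 by rfl, Nat.squarefree_iff_nodup_primeFactorsList (by norm_num)]; simp)
    hjac 16495 (by norm_num) (by norm_num) hmodP hN hGZ hKo hGZK hmod hr hLt hlow _ _ hWd (by simp) hqd hvd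

/-! ## `250065g1` = `[1, -1, 0, 310800, 51948125]`, `N = 250065 = 3^2·5·5557`, `K = ℚ(√-71)`, `Wd = [1, -1, 0, 1566741855, -18621006725854]` (`N(Wd) = 1260577665`), kit j304074 -/
/-- `[1, -1, 0, 1566741855, -18621006725854]` (the minimal model `Wd` of the twist `250065g1^{(-71)}`, change `[u,r,s,t] = [1, -18, 1/2, 0]` from the tree model, conductor `1260577665`) is an elliptic curve: `|Δ| = 3⁶·5¹⁷·71⁶·5557 ≠ 0`. [cite: Cremona2006, Table 1 (Cremona label 250065g1)] -/
theorem isElliptic_sWd250065g1 : (⟨1, -1, 0, 1566741855, -18621006725854⟩ : WeierstrassCurve ℚ).IsElliptic :=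
  isElliptic_of_discOf_ne_zero 1 (-1) 0 1566741855 (-18621006725854) (by decide +kernel)

/-- `[1, -1, 0, 1566741855, -18621006725854]` (the minimal model `Wd` of the twist `250065g1^{(-71)}`, change `[u,r,s,t] = [1, -18, 1/2, 0]` from the tree model, conductor `1260577665`) is globally minimal: `|Δ| = 3⁶·5¹⁷·71⁶·5557` kernel-checked, Kraus/Silverman prime by prime.
[cite: SilvermanAEC2009, VII.1 Remark 1.1] [cite: Kraus1989, Prop. 1 and Prop. 2] [cite: Cremona2006, Table 1 (Cremona label 250065g1)] -/
theorem isGloballyMinimal_sWd250065g1 : (⟨1, -1, 0, 1566741855, -18621006725854⟩ : WeierstrassCurve ℚ).IsGloballyMinimal :=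
  isGloballyMinimal_of_krausCriterion₃_factored 1 (-1) 0 1566741855 (-18621006725854)
    [(3, 6), (5, 17), (71, 6), (5557, 1)] (by decide +kernel)
    (by intro qe hqe; simp only [List.mem_cons, List.not_mem_nil, or_false] at hqe
        rcases hqe with rfl | rfl | rfl | rfl <;> norm_num)
    (by set_option synthInstance.maxSize 2000 in decide +kernel)

/-- **Row membership of `250065g1`, kernel part**: additive (G) ∧ ss at `3` and `ρ_{E,3}` onto (`n = 1` of the tower). The levels
`n ≥ 2`: `ρ_{E,9}` is onto — Frobenius witness `(a_ℓ, ℓ) mod 9 = (2, 7)` at `ℓ = 7`, outside the `(tr, det)`-profile of the 27 index-27 subgroups AND of the index-3 subgroup, these being ALL maximal mod-3-surjective proper subgroups of `GL₂(ℤ/9)`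
(exact enumeration, Lines card `stepl_intrinsic.md` of item 23191) — whence `ρ_{E,3^n}` onto for all `n` by Serre's lifting lemma; not typed here.
[cite: Serre1972, IV-23 Lemma 3 with its Exercise 3 (p = 3: surjectivity mod 9 suffices)] [cite: Cremona2006, Table 1 (Cremona label 250065g1)] -/
theorem row_250065g1 :
    haveI := isElliptic_g250065g1; haveI := isGloballyMinimal_g250065g1
    Addv (⟨1, -1, 0, 310800, 51948125⟩ : WeierstrassCurve ℚ) 3 ∧ SubGss (⟨1, -1, 0, 310800, 51948125⟩ : WeierstrassCurve ℚ) 3 ∧ (⟨1, -1, 0, 310800, 51948125⟩ : WeierstrassCurve ℚ).HasSurjectiveModNGaloisRep (3 ^ 1 : ℕ) := by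
  have h : (⟨1, -1, 0, 310800, 51948125⟩ : WeierstrassCurve ℚ).HasSurjectiveModNGaloisRep ((3 : ℕ) : ℤ) := surj_g250065g1_3
  exact ⟨subGss_g250065g1_3.1, subGss_g250065g1_3.2, by simpa using h⟩

/-- **STEP L (adjusted, tower-row shape) AT `250065g1` over `K = ℚ(√-71)`** — an instance of the `∃`-body of
`Sig.stub_existsAdjustedStepL_towerRows` (= `hEx` of §5) at an INTRINSIC class (`#Ш(E)_an = 9`). KERNEL: `K = sqrtField (-71)` (imaginary
quadratic, `d_K = -71`), the Heegner hypothesis at `N = 250065` (`-71 ≡ 1 (mod 8)`, `(-71/ℓ) = 1` at the odd `ℓ ∣ N`), the Heegner datum `β = 47123`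
(`4N ∣ β² − (-71)`), minimality of `Wd = [1, -1, 0, 1566741855, -18621006725854]` (`Kraus, above`), the twist identity `Cd • E^{(-71)} = Wd`,
`[u,r,s,t] = [1, -18, 1/2, 0]` (`3`-unit), `3 ∤ #𝓞_K^×`; `P ∈ E(K)` over the complex Heegner point is Darmon Thm 3.6 (tree theorem
`heegnerPointComplex_mem_range_map_holds`). PUBLISHED binders: `hmodP` (BCDT), `hGZ`, `hKo`, `hGZK`, `hmod`. DISPLAYED numerics: Cremona's
`N(E) = 250065` (`hN`), `r_an(E) = 1` (`hr`), `#Ш(E)_an = q`, `ord₃ q ≤ 2` (`hq`/`hv`), the rigorous 3-descent certificate `27 ∣ #Sel₃(E)` (`hSel`,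
L1Intrinsic records), `L(E^{(-71)},1) = 0.1313356794 ≠ 0` (`hLt`; PARI `ellL1` = `lfun`, agree True), `#Ш(Wd)_an = 4` (`hqd`/`hvd`;
`N(Wd) = 1260577665`, `∏c(Wd) = 2`, `#Wd(ℚ)_tors = 1`). INSTRUMENT (not used in the proof): Gross–Zagier heights give `[E(K):ℤy_K]² /4 = ρ = ĥ(y_K)/ĥ(P_gen) = 36.0`, `m = 12` (`ord₃ m = 1`; float error 1.8e-15); BSD-budget prediction `ord₃ m = (ord₃#Ш(E)_an + ord₃#Ш(Wd)_an + ord₃∏c(E) + ord₃∏c(Wd))/2 = (2+0+0+0)/2 = 1`.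
Nothing is booked; L₁ / items 26021, 23191 stay OPEN; BSD is not proved by this.
[cite: JetchevSkinnerWan2017, §7.4.1 (pp. 29–31)] [cite: GrossZagier1986, Thm. I.(6.3), V.§2] [cite: Darmon2004, Thm. 3.6]
[cite: SchaeferStoll2004, Cor. 5.9] [cite: Marcus2018, Ch. 3 Thm. 25] [cite: Cremona2006, Table 1 (Cremona label 250065g1)] -/
theorem stepL_at_250065g1
    (hmodP : nonempty_modularParametrizationData)
    (hGZ : ∀ (N : ℕ) [NeZero N] (W : WeierstrassCurve ℚ) (K : Type) [Field K] [NumberField K], gross_zagier N W K)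
    (hKo : ∀ (N : ℕ) [NeZero N] (W : WeierstrassCurve ℚ) (K : Type) [Field K] [NumberField K], kolyvagin N W K)
    (hGZK : rank_eq_analyticRank_of_analyticRank_le_one) (hmod : hasEntireLFunction_rat)
    {W : WeierstrassCurve ℚ} [W.IsElliptic] [W.IsGloballyMinimal] (hWeq : W = (⟨1, -1, 0, 310800, 51948125⟩ : WeierstrassCurve ℚ))
    (hN : W.conductorNorm ℤ = 250065) (hr : W.analyticRank = 1)
    {q : ℚ} (hq : shaAn W = (q : ℂ)) (hv : padicValRat 3 q ≤ 2) (hSel : 3 ^ 3 ∣ Nat.card (W.selmerGroup 3))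
    (hLt : (W.quadraticTwist ((-71 : ℤ) : ℚ)).entireLFunction 1 ≠ 0)
    {qd : ℚ} (hqd : haveI := isElliptic_sWd250065g1; shaAn (⟨1, -1, 0, 1566741855, -18621006725854⟩ : WeierstrassCurve ℚ) = (qd : ℂ)) (hvd : padicValRat 3 qd ≤ 0) :
    ∃ (N : ℕ) (_ : NeZero N) (K : Type) (_ : Field K) (_ : NumberField K)
      (Dt : ModularParametrizationData W N) (H : HeegnerDatum N (NumberField.discr K)) (ι : K →+* ℂ)
      (P : (W.baseChange K).toAffine.Point)
      (Wd : WeierstrassCurve ℚ) (_ : Wd.IsElliptic) (_ : Wd.IsGloballyMinimal) (Cd : VariableChange ℚ),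
      W.conductorNorm ℤ = N ∧ IsImaginaryQuadratic K ∧ SatisfiesHeegnerHypothesis N K ∧
      (W.quadraticTwist (NumberField.discr K : ℚ)).entireLFunction 1 ≠ 0 ∧
      WeierstrassCurve.Affine.Point.map ι.toRatAlgHom P = heegnerPointComplex Dt H ∧
      Cd • W.quadraticTwist (NumberField.discr K : ℚ) = Wd ∧
      (Finite (W.baseChange K).sha →
        (2 * padicValNat 3 (AddSubgroup.zmultiples P).index : ℤ) ≤
          padicValNat 3 (W.baseChange K).shaOrder + padicValNat 3 W.tamagawaProduct +
            padicValNat 3 Wd.tamagawaProduct + 2 * padicValRat 3 (Dt.c : ℚ)) := by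
  subst hWeq
  haveI := isElliptic_sWd250065g1; haveI := isGloballyMinimal_sWd250065g1
  haveI : Fact ((-71 : ℤ) < 0) := ⟨by norm_num⟩
  haveI : NeZero (250065 : ℕ) := ⟨by norm_num⟩
  have hlow : MissingLowerBoundAt (⟨1, -1, 0, 310800, 51948125⟩ : WeierstrassCurve ℚ) 3 :=
    RamifiedHeegnerPairL1Intrinsic.lowerHalf_three_250065g1 hGZK hr hq hv hSel
  have hjac : ∀ ℓ : ℕ, ℓ.Prime → ℓ ∣ 250065 → ℓ ≠ 2 → jacobiSym (-71) ℓ = 1 := by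
    intro ℓ hℓ hℓN hℓ2
    have hmem : ℓ ∈ Nat.primeFactors 250065 := Nat.mem_primeFactors.mpr ⟨hℓ, hℓN, by norm_num⟩
    have hpf : Nat.primeFactors 250065 = {3, 5, 5557} := by decide +kernel
    rw [hpf] at hmem
    simp only [Finset.mem_insert, Finset.mem_singleton] at hmem
    rcases hmem with rfl | rfl | rfl
    all_goals norm_num
  have hWd : (⟨1, ((-18 : ℚ)), ((1 : ℚ)/2), (0 : ℚ)⟩ : VariableChange ℚ) •
      (⟨1, -1, 0, 310800, 51948125⟩ : WeierstrassCurve ℚ).quadraticTwist ((-71 : ℤ) : ℚ) = (⟨1, -1, 0, 1566741855, -18621006725854⟩ : WeierstrassCurve ℚ) := by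
    push_cast
    ext <;> simp [WeierstrassCurve.variableChange_a₁, WeierstrassCurve.variableChange_a₂,
      WeierstrassCurve.variableChange_a₃, WeierstrassCurve.variableChange_a₄, WeierstrassCurve.variableChange_a₆,
      WeierstrassCurve.quadraticTwist, WeierstrassCurve.b₂, WeierstrassCurve.b₄, WeierstrassCurve.b₆] <;> norm_num
  exact existsAdjustedStepLAt_of_sqrtField _ 250065 (-71) (by norm_num)
    (by rw [show (-71 : ℤ).natAbs = 71 by rfl, Nat.squarefree_iff_nodup_primeFactorsList (by norm_num)]; simp)
    hjac 47123 (by norm_num) (by norm_num) hmodP hN hGZ hKo hGZK hmod hr hLt hlow _ _ hWd (by simp) hqd hvd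

/-! ## `228897c1` = `[0, 0, 1, -32274, -2231422]`, `N = 228897 = 3^2·29·877`, `K = ℚ(√-23)`, `Wd = [0, 0, 1, -17072946, 27149708432]` (`N(Wd) = 121086513`), kit j304074 -/

/-- **Row membership of `228897c1`, kernel part**: additive (G) ∧ ss at `3` and `ρ_{E,3}` onto (`n = 1` of the tower). The levels
`n ≥ 2`: `ρ_{E,9}` is onto — Frobenius witness `(a_ℓ, ℓ) mod 9 = (2, 5)` at `ℓ = 5`, outside the `(tr, det)`-profile of the 27 index-27 subgroups AND of the index-3 subgroup, these being ALL maximal mod-3-surjective proper subgroups of `GL₂(ℤ/9)`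
(exact enumeration, Lines card `stepl_intrinsic.md` of item 23191) — whence `ρ_{E,3^n}` onto for all `n` by Serre's lifting lemma; not typed here.
[cite: Serre1972, IV-23 Lemma 3 with its Exercise 3 (p = 3: surjectivity mod 9 suffices)] [cite: Cremona2006, Table 1 (Cremona label 228897c1)] -/
theorem row_228897c1 :
    haveI := isElliptic_g228897c1; haveI := isGloballyMinimal_g228897c1
    Addv (⟨0, 0, 1, -32274, -2231422⟩ : WeierstrassCurve ℚ) 3 ∧ SubGss (⟨0, 0, 1, -32274, -2231422⟩ : WeierstrassCurve ℚ) 3 ∧ (⟨0, 0, 1, -32274, -2231422⟩ : WeierstrassCurve ℚ).HasSurjectiveModNGaloisRep (3 ^ 1 : ℕ) := by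
  have h : (⟨0, 0, 1, -32274, -2231422⟩ : WeierstrassCurve ℚ).HasSurjectiveModNGaloisRep ((3 : ℕ) : ℤ) := surj_g228897c1_3
  exact ⟨subGss_g228897c1_3.1, subGss_g228897c1_3.2, by simpa using h⟩

/-- **STEP L (adjusted, tower-row shape) AT `228897c1` over `K = ℚ(√-23)`** — an instance of the `∃`-body of
`Sig.stub_existsAdjustedStepL_towerRows` (= `hEx` of §5) at an INTRINSIC class (`#Ш(E)_an = 9`). KERNEL: `K = sqrtField (-23)` (imaginary
quadratic, `d_K = -23`), the Heegner hypothesis at `N = 228897` (`-23 ≡ 1 (mod 8)`, `(-23/ℓ) = 1` at the odd `ℓ ∣ N`), the Heegner datum `β = 73523`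
(`4N ∣ β² − (-23)`), minimality of `Wd = [0, 0, 1, -17072946, 27149708432]` (`k1 record, by name`), the twist identity `Cd • E^{(-23)} = Wd`,
`[u,r,s,t] = [1, 0, 0, 1/2]` (`3`-unit), `3 ∤ #𝓞_K^×`; `P ∈ E(K)` over the complex Heegner point is Darmon Thm 3.6 (tree theorem
`heegnerPointComplex_mem_range_map_holds`). PUBLISHED binders: `hmodP` (BCDT), `hGZ`, `hKo`, `hGZK`, `hmod`. DISPLAYED numerics: Cremona's
`N(E) = 228897` (`hN`), `r_an(E) = 1` (`hr`), `#Ш(E)_an = q`, `ord₃ q ≤ 2` (`hq`/`hv`), the rigorous 3-descent certificate `27 ∣ #Sel₃(E)` (`hSel`,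
L1Intrinsic records), `L(E^{(-23)},1) = 3.0114024663 ≠ 0` (`hLt`; PARI `ellL1` = `lfun`, agree True), `#Ш(Wd)_an = 1` (`hqd`/`hvd`;
`N(Wd) = 121086513`, `∏c(Wd) = 16`, `#Wd(ℚ)_tors = 1`). INSTRUMENT (not used in the proof): Gross–Zagier heights give `[E(K):ℤy_K]² /4 = ρ = ĥ(y_K)/ĥ(P_gen) = 576.0`, `m = 48` (`ord₃ m = 1`; float error 7.1e-15); BSD-budget prediction `ord₃ m = (ord₃#Ш(E)_an + ord₃#Ш(Wd)_an + ord₃∏c(E) + ord₃∏c(Wd))/2 = (2+0+0+0)/2 = 1`.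
Nothing is booked; L₁ / items 26021, 23191 stay OPEN; BSD is not proved by this.
[cite: JetchevSkinnerWan2017, §7.4.1 (pp. 29–31)] [cite: GrossZagier1986, Thm. I.(6.3), V.§2] [cite: Darmon2004, Thm. 3.6]
[cite: SchaeferStoll2004, Cor. 5.9] [cite: Marcus2018, Ch. 3 Thm. 25] [cite: Cremona2006, Table 1 (Cremona label 228897c1)] -/
theorem stepL_at_228897c1
    (hmodP : nonempty_modularParametrizationData)
    (hGZ : ∀ (N : ℕ) [NeZero N] (W : WeierstrassCurve ℚ) (K : Type) [Field K] [NumberField K], gross_zagier N W K)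
    (hKo : ∀ (N : ℕ) [NeZero N] (W : WeierstrassCurve ℚ) (K : Type) [Field K] [NumberField K], kolyvagin N W K)
    (hGZK : rank_eq_analyticRank_of_analyticRank_le_one) (hmod : hasEntireLFunction_rat)
    {W : WeierstrassCurve ℚ} [W.IsElliptic] [W.IsGloballyMinimal] (hWeq : W = (⟨0, 0, 1, -32274, -2231422⟩ : WeierstrassCurve ℚ))
    (hN : W.conductorNorm ℤ = 228897) (hr : W.analyticRank = 1)
    {q : ℚ} (hq : shaAn W = (q : ℂ)) (hv : padicValRat 3 q ≤ 2) (hSel : 3 ^ 3 ∣ Nat.card (W.selmerGroup 3))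
    (hLt : (W.quadraticTwist ((-23 : ℤ) : ℚ)).entireLFunction 1 ≠ 0)
    {qd : ℚ} (hqd : haveI := isElliptic_gWd228897c1; shaAn (⟨0, 0, 1, -17072946, 27149708432⟩ : WeierstrassCurve ℚ) = (qd : ℂ)) (hvd : padicValRat 3 qd ≤ 0) :
    ∃ (N : ℕ) (_ : NeZero N) (K : Type) (_ : Field K) (_ : NumberField K)
      (Dt : ModularParametrizationData W N) (H : HeegnerDatum N (NumberField.discr K)) (ι : K →+* ℂ)
      (P : (W.baseChange K).toAffine.Point)
      (Wd : WeierstrassCurve ℚ) (_ : Wd.IsElliptic) (_ : Wd.IsGloballyMinimal) (Cd : VariableChange ℚ),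
      W.conductorNorm ℤ = N ∧ IsImaginaryQuadratic K ∧ SatisfiesHeegnerHypothesis N K ∧
      (W.quadraticTwist (NumberField.discr K : ℚ)).entireLFunction 1 ≠ 0 ∧
      WeierstrassCurve.Affine.Point.map ι.toRatAlgHom P = heegnerPointComplex Dt H ∧
      Cd • W.quadraticTwist (NumberField.discr K : ℚ) = Wd ∧
      (Finite (W.baseChange K).sha →
        (2 * padicValNat 3 (AddSubgroup.zmultiples P).index : ℤ) ≤
          padicValNat 3 (W.baseChange K).shaOrder + padicValNat 3 W.tamagawaProduct +
            padicValNat 3 Wd.tamagawaProduct + 2 * padicValRat 3 (Dt.c : ℚ)) := by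
  subst hWeq
  haveI := isElliptic_gWd228897c1; haveI := isGloballyMinimal_gWd228897c1
  haveI : Fact ((-23 : ℤ) < 0) := ⟨by norm_num⟩
  haveI : NeZero (228897 : ℕ) := ⟨by norm_num⟩
  have hlow : MissingLowerBoundAt (⟨0, 0, 1, -32274, -2231422⟩ : WeierstrassCurve ℚ) 3 :=
    RamifiedHeegnerPairL1Intrinsic.lowerHalf_three_228897c1 hGZK hr hq hv hSel
  have hjac : ∀ ℓ : ℕ, ℓ.Prime → ℓ ∣ 228897 → ℓ ≠ 2 → jacobiSym (-23) ℓ = 1 := by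
    intro ℓ hℓ hℓN hℓ2
    have hmem : ℓ ∈ Nat.primeFactors 228897 := Nat.mem_primeFactors.mpr ⟨hℓ, hℓN, by norm_num⟩
    have hpf : Nat.primeFactors 228897 = {3, 29, 877} := by decide +kernel
    rw [hpf] at hmem
    simp only [Finset.mem_insert, Finset.mem_singleton] at hmem
    rcases hmem with rfl | rfl | rfl
    all_goals norm_num
  have hWd : (⟨1, (0 : ℚ), (0 : ℚ), ((1 : ℚ)/2)⟩ : VariableChange ℚ) •
      (⟨0, 0, 1, -32274, -2231422⟩ : WeierstrassCurve ℚ).quadraticTwist ((-23 : ℤ) : ℚ) = (⟨0, 0, 1, -17072946, 27149708432⟩ : WeierstrassCurve ℚ) := by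
    push_cast
    ext <;> simp [WeierstrassCurve.variableChange_a₁, WeierstrassCurve.variableChange_a₂,
      WeierstrassCurve.variableChange_a₃, WeierstrassCurve.variableChange_a₄, WeierstrassCurve.variableChange_a₆,
      WeierstrassCurve.quadraticTwist, WeierstrassCurve.b₂, WeierstrassCurve.b₄, WeierstrassCurve.b₆] <;> norm_num
  exact existsAdjustedStepLAt_of_sqrtField _ 228897 (-23) (by norm_num)
    (by rw [show (-23 : ℤ).natAbs = 23 by rfl, Nat.squarefree_iff_nodup_primeFactorsList (by norm_num)]; simp)
    hjac 73523 (by norm_num) (by norm_num) hmodP hN hGZ hKo hGZK hmod hr hLt hlow _ _ hWd (by simp) hqd hvd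

end Summit.BirchSwinnertonDyer.BirchSwinnertonDyer.Theorems.RamifiedHeegnerPairStepLIntrinsic

end
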